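import Summits.Langlands.Langlands.Theorems.AdjointLiftingGL3.Negative.SeedAdmitsEisenstein
import Literature.NumberTheory.GaloisRepresentations.AbsIrreducibleIndexTwo
import HarnessLib

/-!
# `AdjointLiftingGL3` (crux stmt-Langlands-16779): the Eisenstein witness fails EXACTLY the
# residual-irreducibility hypothesis (negative-side support, refuter cdisprove seat; sorry-free)

Sharpening of `SeedAdmitsEisenstein`: the witness `ρ_Eis = 1 ⊕ ε⁻¹ ⊕ ε⁻²` of that file (which
meets the adjoint seed with an odd `ρ₀`, and "unramified a.e.") violates precisely the hypothesis
`(ρ.restrictField (CyclotomicField p ℚ)).IsResiduallyAbsIrreducible` of the crux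
`Summit.Langlands.Langlands.Theses.RamifiedCoefficientSeed.AdjointLiftingGL3`:

* `not_isIrreducible_of_forall_diagonal` — a framed representation by diagonal matrices is
  reducible in rank `≥ 2` (rank-`(n+2)` form of the tree's `not_isIrreducible_of_diagonal_two`);
* `rhoEis_restrictField_not_isIrreducible` — so is `ρ_Eis|_{Γ_L}` for every `L/ℚ`;
* `rhoEis_not_isResiduallyAbsIrreducible` — hence `ρ_Eis|_{Γ_L}` is not residually absolutely
  irreducible (residual absolute irreducibility lifts to absolute irreducibility:
  `IsResiduallyAbsIrreducible.isAbsolutelyIrreducible`, Darmon–Diamond–Taylor §2.1);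
* `eisenstein_meets_all_but_residualIrreducibility` — packaging with the facts of
  `SeedAdmitsEisenstein`: seed + oddness + unramified-a.e. hold and the residual hypothesis FAILS,
  for one and the same `ρ`.  Together with `adjointLiftingGL3_false_without_residualIrreducibility`
  this pins residual absolute irreducibility over `ℚ(ζ_p)` as THE load-bearing hypothesis of the
  crux among those a counterexample could exploit (the others being Fontaine–Mazur-shielded).

This file does NOT refute the crux.
-/

noncomputable section

open scoped MatrixGroups NumberField
open NumberField IsDedekindDomain Filter Field
open Literature.NumberTheory.GaloisRepresentations

namespace Summit.Langlands.Langlands.Theorems.AdjointLiftingGL3.Negative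

set_option linter.dupNamespace false -- project-wide option; `Summit.Langlands.Langlands` is the mandated namespace

/-- **A framed representation by diagonal matrices is reducible in rank `≥ 2`**: the coordinate
hyperplane `{x | x 1 = 0}` is a subrepresentation different from `⊥` (it contains `e₀`) and from
`⊤` (it misses `e₁`).  Rank-`(n+2)` version of the tree's `FramedRep.not_isIrreducible_of_diagonal_two`.
[folklore] -/
theorem not_isIrreducible_of_forall_diagonal {G : Type*} [Group G] [TopologicalSpace G]
    {A : Type*} [Field A] [TopologicalSpace A] {n : ℕ} (s : FramedRep G A (n + 2))
    (d : G → Fin (n + 2) → A)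
    (hs : ∀ g : G, ((s g : GL (Fin (n + 2)) A) : Matrix (Fin (n + 2)) (Fin (n + 2)) A) =
      Matrix.diagonal (d g)) :
    ¬ FramedRep.IsIrreducible s := by
  classical
  intro hirr
  set ρ := FramedRep.toRepresentation s with hρ
  have hact : ∀ (g : G) (x : Fin (n + 2) → A) (i : Fin (n + 2)), ρ g x i = d g i * x i := by
    intro g x i
    rw [hρ, FramedRep.toRepresentation_apply_apply, hs, Matrix.mulVec_diagonal]
  let L : Subrepresentation ρ :=
    { toSubmodule := LinearMap.ker (LinearMap.proj 1 : (Fin (n + 2) → A) →ₗ[A] A)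
      apply_mem_toSubmodule := fun g x hx => by
        simp only [LinearMap.mem_ker, LinearMap.proj_apply] at hx ⊢
        rw [hact, hx, mul_zero] }
  have hmem : ∀ x : Fin (n + 2) → A, x ∈ L.toSubmodule ↔ x 1 = 0 := fun x => by simp [L]
  rcases hirr.eq_bot_or_eq_top L with h | h
  · have h0 : (Pi.single (0 : Fin (n + 2)) (1 : A) : Fin (n + 2) → A) ∈ L.toSubmodule :=
      (hmem _).2 (by simp)
    rw [h] at h0
    change (Pi.single (0 : Fin (n + 2)) (1 : A) : Fin (n + 2) → A) ∈
      (⊥ : Submodule A (Fin (n + 2) → A)) at h0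
    rw [Submodule.mem_bot] at h0
    have h00 := congrFun h0 0
    simp only [Pi.single_eq_same, Pi.zero_apply] at h00
    exact one_ne_zero h00
  · have h1 : (Pi.single (1 : Fin (n + 2)) (1 : A) : Fin (n + 2) → A) ∈ L.toSubmodule := by
      rw [h]
      change (Pi.single (1 : Fin (n + 2)) (1 : A) : Fin (n + 2) → A) ∈
        (⊤ : Submodule A (Fin (n + 2) → A))
      exact Submodule.mem_top
    rw [hmem] at h1
    simp only [Pi.single_eq_same] at h1
    exact one_ne_zero h1

variable {p : ℕ} [Fact p.Prime]

/-- **`ρ_Eis|_{Γ_L}` is reducible** for every extension `L/ℚ` (the restriction of a diagonal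
representation is diagonal). [folklore] -/
theorem rhoEis_restrictField_not_isIrreducible (L : Type*) [Field L] [Algebra ℚ L] :
    ¬ FramedRep.IsIrreducible ((rhoEis p).restrictField L) :=
  not_isIrreducible_of_forall_diagonal ((rhoEis p).restrictField L)
    (fun σ => diagEntries ![epsPow p 0, epsPow p (-1), epsPow p (-2)] (absGaloisRestrict ℚ L σ))
    fun _ => rfl

/-- **`ρ_Eis` FAILS the crux's residual hypothesis**: `ρ_Eis|_{Γ_L}` is not residually absolutely
irreducible for any `L/ℚ` (in particular `L = ℚ(ζ_p)`), since residual absolute irreducibility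
implies absolute irreducibility (`IsResiduallyAbsIrreducible.isAbsolutelyIrreducible`) and
`ρ_Eis|_{Γ_L}` is reducible. [cite: DarmonDiamondTaylor1995, §2.1] -/
theorem rhoEis_not_isResiduallyAbsIrreducible (L : Type*) [Field L] [Algebra ℚ L] :
    ¬ ((rhoEis p).restrictField L).IsResiduallyAbsIrreducible := fun h =>
  rhoEis_restrictField_not_isIrreducible L
    ((FramedGaloisRep.IsResiduallyAbsIrreducible.isAbsolutelyIrreducible (by norm_num) h).isIrreducible)

variable (p)

/-- **The Eisenstein triple meets every seed-side hypothesis of `AdjointLiftingGL3` and fails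
exactly `IsResiduallyAbsIrreducible` over `ℚ(ζ_p)`**: there are `ρ`, an ODD `ρ₀` and `η` with the
crux's seed inequality for all `σ`, `ρ` unramified almost everywhere, and
`¬ (ρ.restrictField (CyclotomicField p ℚ)).IsResiduallyAbsIrreducible`
(`ρ = 1 ⊕ ε⁻¹ ⊕ ε⁻²`, `ρ₀ = 1 ⊕ ε⁻¹`, `η = ε⁻¹`).  Hence the residual hypothesis is not implied by
the others, and (with `adjointLiftingGL3_false_without_residualIrreducibility`) it is the
load-bearing one. [folklore] -/
theorem eisenstein_meets_all_but_residualIrreducibility :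
    ∃ (ρ : FramedGaloisRep ℚ (PadicAlgCl p) 3) (ρ₀ : FramedGaloisRep ℚ (PadicAlgCl p) 2)
      (η : FramedGaloisRep ℚ (PadicAlgCl p) 1),
      ρ₀.IsOdd ∧
      (∀ σ, ‖(ρ σ).val.trace - (η σ).val 0 0 * ((ρ₀ σ).val.trace ^ 2 * ((ρ₀ σ).val.det)⁻¹ - 1)‖ < 1) ∧
      (∀ᶠ v : HeightOneSpectrum (𝓞 ℚ) in cofinite, ρ.IsUnramifiedAt v) ∧
      ¬ (ρ.restrictField (CyclotomicField p ℚ)).IsResiduallyAbsIrreducible :=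
  ⟨rhoEis p, rho0 p, eta p, rho0_isOdd, seed_norm_lt_one, rhoEis_unramified_ae,
    rhoEis_not_isResiduallyAbsIrreducible _⟩

end Summit.Langlands.Langlands.Theorems.AdjointLiftingGL3.Negative

end
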